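import Mathlib.Analysis.SpecialFunctions.Log.NegMulLog
import Mathlib.Analysis.SpecialFunctions.Log.Base
import Mathlib.Tactic.IntervalCases
import Literature.Computability.AlgebraicComplexity.MatrixMultiplicationExponent
import Literature.Computability.AlgebraicComplexity.MaxEntropyCertificate
import HarnessLib

/-!
# The combination-loss laser program at level `ℓ* = 2` (square of `CW_q`): typed statement
(Dupont–Eisenberger–Kozlovskii–Mehrabian–Ruiz–See–Zhou–Alman–Vassilevska Williams–Balog 2026, §2,
program (11) and Theorem 1 = Alman–Duan–Vassilevska Williams–Xu–Xu–Zhou 2025, §7)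

Topic `Literature/Computability/AlgebraicComplexity`.  E. Dupont et al., *Improving the matrix
multiplication exponent with modern optimization and AlphaEvolve*, arXiv:2608.16884v1 (17 Aug 2026), §2,
restate the optimisation problem of Alman–Duan–Vassilevska Williams–Xu–Xu–Zhou (SODA 2025, §7) — the
"combination loss" analysis of the laser method on `CW_q^{⊗2^{ℓ*−1}}` — as an explicit program over a
rooted tree of parameters, their eq. (11):

> minimize `Ω` subject to `E_total + M_total · Ω ≥ 2^{ℓ*−1} log(q+2)`, all free variables in their domains;
> **Theorem 1 (Alman et al. (2025)).** Any feasible solution of Equation (11) implies `ω ≤ Ω`.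

This file TYPES the smallest instance, `ℓ* = 2` (the analysis of `CW_q ⊗ CW_q`; Alman et al. 2025,
§2.4: "our new approach gives a better analysis of `CW_q^{⊗2}` than prior work, improving … to
`ω < 2.37432`"), verbatim from the note's §2 with `ℓ* = 2` substituted: the tree then has only the root
`G` and its `6 · 15` leaf children `G[s, r]` (`s ∈ S₂ = {(i,j,k) : i+j+k = 4}`, regions `r ∈ [6]`), so
the recursive clauses of §2 for levels `ℓ ≥ 3` are void and every quantity below is an explicit finite
sum.  Logarithms and entropies are base 2 (note §2.3).  Nothing is proved here: the definitions are the
paper's, and Theorem 1 (case `ℓ* = 2`) is recorded as the NAMED FACT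
`combinationLoss2_theorem1 : Prop` (statement only; its proof is §4–§6 of Alman et al. 2025, not
formalised).  Purpose: the interface against which exact rational feasible points of (11) — the
certificates of the ω-construction census, family (c) (`run/shared/lean/pub/pub-omega/pub-omega-laser/`,
schema `SCHEMA-c.md` v1) — can later be checked by the kernel (`FixedPointLog.lean` enclosures).
HONEST FRAMING (census, verbatim): lottery ticket; floor = certified bounds/negative ranges.  Every bound
obtained through this interface is CONDITIONAL on the named fact; the tree's unconditional record
remains `LeGall2014_cw4_omega_le : ω ≤ 2.37295`.

Dictionary (note §2 ↔ this file): shapes `S_ℓ` ↔ `shapes2` (as `ℕ × ℕ × ℕ`); regions `r ∈ [6]`,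
`π_r` ↔ `Fin 6`, `role r` (0-based: `role r 0/1/2` = the actual coordinate playing the rôle of `X/Y/Z`);
complete split vectors `L ∈ {0,1,2}^{2^{ℓ−1}} = {0,1,2}²` ↔ `ℕ × ℕ`, `csplit2 a`; the free variables
`A_G, α_G^{(r)}, μ_T, β_{T,W₁}` ↔ the fields of `Point`; `H`, `H^max_D`, `P_D` ↔ `Hb`, `hmax`, `penalty`;
masses `m_{G[s,r]} = A^{(r)} α^{(r)}(s)` ↔ `mass`; eq. (2) ↔ `leafBeta`; eqs. (3)–(5) ↔ `etaY`, `etaZ`,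
`regionTerm*`, `EG`; eq. (9) ↔ `E2`; eq. (10) and the zero-shape sizes ↔ `Mcoord`; (11) ↔ `Feasible`.

## References

* E. Dupont, M. Eisenberger, B. Kozlovskii, A. Mehrabian, F. J. R. Ruiz, A. See, R. Zhou, J. Alman,
  V. Vassilevska Williams, M. Balog, arXiv:2608.16884v1 (2026), §2 (pp. 2–8), eq. (2)–(11), Thm. 1,
  Lemma 1. [DupontEtAl2026]
* J. Alman, R. Duan, V. Vassilevska Williams, Y. Xu, Z. Xu, R. Zhou, *More asymmetry yields faster
  matrix multiplication*, SODA 2025, arXiv:2404.16349, §2.4 (`CW_q^{⊗2}`: `ω < 2.37432`) and §7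
  (the optimisation problem; `N = 2^{ℓ*−1} n`). [AlmanDuanVassilevskaWilliamsXuXuZhou2025]
-/

noncomputable section

open scoped BigOperators
open Finset Real

namespace Literature.Computability.AlgebraicComplexity

namespace CombinationLoss2

/-! ## Shapes, regions, complete split vectors (note §2.1–§2.2 at `ℓ* = 2`) -/

/-- A shape `(s_X, s_Y, s_Z)`. [cite: DupontEtAl2026, §2.1] -/
abbrev Shape := ℕ × ℕ × ℕ

/-- Coordinate `c ∈ {X, Y, Z} = {0, 1, 2}` of a shape. [cite: DupontEtAl2026, §2.1] -/
def coord (s : Shape) (c : Fin 3) : ℕ :=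
  match c with
  | 0 => s.1
  | 1 => s.2.1
  | 2 => s.2.2

/-- `S₂ = {(i, j, k) ∈ ℤ³_{≥0} : i + j + k = 2² = 4}` (15 shapes). [cite: DupontEtAl2026, §2.1] -/
def shapes2 : Finset Shape :=
  {(0, 0, 4), (0, 1, 3), (0, 2, 2), (0, 3, 1), (0, 4, 0), (1, 0, 3), (1, 1, 2), (1, 2, 1), (1, 3, 0),
    (2, 0, 2), (2, 1, 1), (2, 2, 0), (3, 0, 1), (3, 1, 0), (4, 0, 0)}

/-- Positive-shape: all coordinates positive (at level 2: `(1,1,2)`, `(1,2,1)`, `(2,1,1)`).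
[cite: DupontEtAl2026, §2.1] -/
def IsPos (s : Shape) : Prop := 0 < s.1 ∧ 0 < s.2.1 ∧ 0 < s.2.2

/-- Positivity of a shape is decidable. [folklore] -/
instance (s : Shape) : Decidable (IsPos s) := by unfold IsPos; infer_instance

/-- The six regions: `role r i` is the ACTUAL coordinate playing the rôle of coordinate `i` of the
region-1 formulas, i.e. `π_r` = the `r`-th permutation of `(X, Y, Z)` in lexicographic order
`XYZ, XZY, YXZ, YZX, ZXY, ZYX`. [cite: DupontEtAl2026, §2.1] -/
def role (r : Fin 6) (i : Fin 3) : Fin 3 :=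
  (![![0, 1, 2], ![0, 2, 1], ![1, 0, 2], ![1, 2, 0], ![2, 0, 1], ![2, 1, 0]] : Fin 6 → Fin 3 → Fin 3) r i

/-- Level-2 complete split vectors `L = (L₁, L₂) ∈ {0,1,2}²` (all nine; distributions are supported on
`csplit2 a`). [cite: DupontEtAl2026, §2.2] -/
def splitVecs : Finset (ℕ × ℕ) := range 3 ×ˢ range 3

/-- `C_{2,a} = {L ∈ {0,1,2}² : L₁ + L₂ = a}`. [cite: DupontEtAl2026, §2.2] -/
def csplit2 (a : ℕ) : Finset (ℕ × ℕ) := splitVecs.filter (fun L => L.1 + L.2 = a)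

/-- Number of entries of `L` equal to `1` (enters the local matrix size of a zero-shape node).
[cite: DupontEtAl2026, §2.3] -/
def ones (L : ℕ × ℕ) : ℕ := (if L.1 = 1 then 1 else 0) + (if L.2 = 1 then 1 else 0)

/-- `L ↦ 2⃗ − L` (the map `β ↦ β^∨`). [cite: DupontEtAl2026, §2.3] -/
def vee (L : ℕ × ℕ) : ℕ × ℕ := (2 - L.1, 2 - L.2)

/-- First zero coordinate `W₀` of a zero-shape (junk `0` on positive shapes). [cite: DupontEtAl2026, §2.2] -/
def firstZero (s : Shape) : Fin 3 := if s.1 = 0 then 0 else if s.2.1 = 0 then 1 else 2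

/-- First nonzero coordinate `W₁` of a shape (junk `2` on `(0,0,0)`). [cite: DupontEtAl2026, §2.2] -/
def firstNonzero (s : Shape) : Fin 3 := if s.1 ≠ 0 then 0 else if s.2.1 ≠ 0 then 1 else 2

/-- The remaining coordinate `W₂` of a zero-shape. [cite: DupontEtAl2026, §2.3] -/
def otherCoord (s : Shape) : Fin 3 := 3 - firstZero s - firstNonzero s

/-! ## Free variables (note §2.2 at `ℓ* = 2`) and their domains -/

/-- A parameter point of program (11) at `ℓ* = 2`: the root's region distribution `A_G ∈ Δ([6])` and
shape distributions `α_G^{(r)} ∈ Δ(S₂)`; for each leaf `G[s,r]`: the scalar `μ ∈ [0, 1/2]` when `s` is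
a positive shape, the complete split distribution `β_{W₁} ∈ Δ(C_{2, s_{W₁}})` when `s` is a zero-shape
(unused fields are ignored). [cite: DupontEtAl2026, §2.2] -/
structure Point where
  /-- `A_G^{(r)}`. -/
  A : Fin 6 → ℝ
  /-- `α_G^{(r)}(s)`. -/
  alpha : Fin 6 → Shape → ℝ
  /-- `μ_{G[s,r]}` for positive `s`. -/
  mu : Fin 6 → Shape → ℝ
  /-- `β_{G[s,r], W₁}(L)` for zero-shapes `s`. -/
  beta : Fin 6 → Shape → ℕ × ℕ → ℝ

/-- The domain constraints of §2.2 ("all free variables lie in the domains stated").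
[cite: DupontEtAl2026, §2.2 and eq. (11)] -/
structure Point.Valid (P : Point) : Prop where
  A_nonneg : ∀ r, 0 ≤ P.A r
  A_sum : ∑ r, P.A r = 1
  alpha_nonneg : ∀ r s, 0 ≤ P.alpha r s
  alpha_supp : ∀ r s, s ∉ shapes2 → P.alpha r s = 0
  alpha_sum : ∀ r, ∑ s ∈ shapes2, P.alpha r s = 1
  mu_mem : ∀ r s, IsPos s → 0 ≤ P.mu r s ∧ P.mu r s ≤ 1 / 2
  beta_nonneg : ∀ r s L, 0 ≤ P.beta r s L
  beta_supp : ∀ r s L, ¬ IsPos s → L ∉ csplit2 (coord s (firstNonzero s)) → P.beta r s L = 0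
  beta_sum : ∀ r s, s ∈ shapes2 → ¬ IsPos s → ∑ L ∈ csplit2 (coord s (firstNonzero s)), P.beta r s L = 1

/-! ## Entropies (base 2) and the max-entropy penalty (note §2.3, eq. (1)) -/

/-- `H(ρ) = −∑ ρ log₂ ρ` over a finite index set (`0 log 0 = 0`). [cite: DupontEtAl2026, §2.3] -/
def Hb {ι : Type*} (D : Finset ι) (f : ι → ℝ) : ℝ := ∑ i ∈ D, Real.negMulLog (f i) / Real.log 2

/-- Marginal of a shape distribution in coordinate `c` at value `v`. [cite: DupontEtAl2026, §2.3] -/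
def marg (D : Finset Shape) (ρ : Shape → ℝ) (c : Fin 3) (v : ℕ) : ℝ :=
  ∑ s ∈ D.filter (fun s => coord s c = v), ρ s

/-- Entropy of the `c`-marginal (values `0..4` at level 2). [cite: DupontEtAl2026, §2.3] -/
def Hmarg (D : Finset Shape) (ρ : Shape → ℝ) (c : Fin 3) : ℝ := Hb (range 5) (marg D ρ c)

/-- `H^max_D(ρ) = sup {H(ρ') : ρ' ∈ Δ(D), ρ'_W = ρ_W for W ∈ {X,Y,Z}}` (eq. (1)).
[cite: DupontEtAl2026, §2.3 eq. (1)] -/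
def hmax (D : Finset Shape) (ρ : Shape → ℝ) : ℝ :=
  sSup {h : ℝ | ∃ ρ' : Shape → ℝ, (∀ s, 0 ≤ ρ' s) ∧ (∀ s, s ∉ D → ρ' s = 0) ∧
    (∀ c v, marg D ρ' c v = marg D ρ c v) ∧ h = Hb D ρ'}

/-- The penalty `P_D(ρ) = H^max_D(ρ) − H(ρ)`. [cite: DupontEtAl2026, §2.3] -/
def penalty (D : Finset Shape) (ρ : Shape → ℝ) : ℝ := hmax D ρ - Hb D ρ

/-! ## Leaves: masses, complete split distributions (eq. (2)), level-2 exponents and sizes -/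

/-- Mass of the leaf `G[s,r]`: `m = A_G^{(r)} α_G^{(r)}(s)`. [cite: DupontEtAl2026, §2.3 (Masses)] -/
def mass (P : Point) (r : Fin 6) (s : Shape) : ℝ := P.A r * P.alpha r s

/-- The complete split distribution `β_{G[s,r], c}` of a leaf in coordinate `c` (eq. (2) for the three
positive shapes; `δ_{0⃗}`, the free `β_{W₁}`, and `β^∨` for zero-shapes).
[cite: DupontEtAl2026, §2.3 eq. (2)] -/
def leafBeta (P : Point) (r : Fin 6) (s : Shape) (c : Fin 3) (L : ℕ × ℕ) : ℝ :=
  if IsPos s then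
    (if coord s c = 2 then
      (if L = (0, 2) ∨ L = (2, 0) then P.mu r s else if L = (1, 1) then 1 - 2 * P.mu r s else 0)
    else (if L = (0, 1) ∨ L = (1, 0) then 1 / 2 else 0))
  else
    (if c = firstZero s then (if L = (0, 0) then 1 else 0)
    else if c = firstNonzero s then P.beta r s L
    else (if L ∈ splitVecs then P.beta r s (vee L) else 0))

/-- `H(μ, μ, 1 − 2μ)`. [cite: DupontEtAl2026, §2.3 eq. (9)] -/
def h3 (μ : ℝ) : ℝ := Hb (univ : Finset (Fin 3)) ![μ, μ, 1 - 2 * μ]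

/-- Positive level-2 shapes. [cite: DupontEtAl2026, §2.2] -/
def posShapes2 : Finset Shape := shapes2.filter IsPos

/-- Zero-shapes of `S₂`. [cite: DupontEtAl2026, §2.1] -/
def zeroShapes2 : Finset Shape := shapes2.filter (fun s => ¬ IsPos s)

/-- `∑_{T ∈ T⁺₂} E_{T,c}` with `(E_X, E_Y, E_Z) = m_T · (1, 1, H(μ,μ,1−2μ))` for shape `(1,1,2)` and its
permutations (the `H` sits on the coordinate where the shape has the entry `2`), eq. (9).
[cite: DupontEtAl2026, §2.3 eq. (9)] -/
def E2coord (P : Point) (c : Fin 3) : ℝ :=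
  ∑ r, ∑ s ∈ posShapes2, mass P r s * (if coord s c = 2 then h3 (P.mu r s) else 1)

/-- `E₂ = min_c ∑_T E_{T,c}`. [cite: DupontEtAl2026, §2.3 eq. (9)] -/
def E2 (P : Point) : ℝ := min (E2coord P 0) (min (E2coord P 1) (E2coord P 2))

/-- `∑_{leaves} M_{T,c}`: positive leaves contribute `m_T (1−2μ) log q` on the two coordinates with entry
`1` and `m_T · 2μ log q` on the coordinate with entry `2` (eq. (10)); a zero-shape leaf contributes
`m_T (H(β_{W₁}) + ∑_L β_{W₁}(L) |{p : L_p = 1}| log q)` on its first zero coordinate `W₀` and `0`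
elsewhere. [cite: DupontEtAl2026, §2.3 eq. (10)] -/
def Mcoord (q : ℕ) (P : Point) (c : Fin 3) : ℝ :=
  ∑ r, ((∑ s ∈ posShapes2, mass P r s *
      (if coord s c = 2 then 2 * P.mu r s else 1 - 2 * P.mu r s) * Real.logb 2 q) +
    (∑ s ∈ zeroShapes2, if firstZero s = c then
      mass P r s * (Hb splitVecs (P.beta r s) +
        (∑ L ∈ splitVecs, P.beta r s L * (ones L : ℝ)) * Real.logb 2 q) else 0))

/-- `M_total = min_c ∑_{leaves} M_{T,c}`. [cite: DupontEtAl2026, §2.4] -/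
def Mtotal (q : ℕ) (P : Point) : ℝ := min (Mcoord q P 0) (min (Mcoord q P 1) (Mcoord q P 2))

/-! ## The root's retained exponent (eqs. (3)–(5)) -/

/-- `η^{(r)}_{G,Y}` (eq. (3) with rôles relabelled by region `r`): shapes with `s_Z = 0` contribute
`α(s) H(β_{G[s,r],Y})`; the others are grouped by `j = s_Y` and contribute
`α(*,j,+) · H(β̄_{Y,*,j,+})` with `β̄` the `α`-weighted average (`0 · undefined := 0`).
[cite: DupontEtAl2026, §2.3 eq. (3)] -/
def etaY (P : Point) (r : Fin 6) : ℝ :=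
  let cy := role r 1
  let cz := role r 2
  let α := P.alpha r
  (∑ s ∈ shapes2.filter (fun s => coord s cz = 0), α s * Hb splitVecs (leafBeta P r s cy)) +
  ∑ j ∈ range 5,
    (let G := shapes2.filter (fun s => coord s cy = j ∧ 0 < coord s cz)
     let W := ∑ s ∈ G, α s
     if W = 0 then 0 else W * Hb splitVecs (fun L => (∑ s ∈ G, α s * leafBeta P r s cy L) / W))

/-- `η^{(r)}_{G,Z}` (eq. (4)): shapes with `s_X = 0` or `s_Y = 0` contribute `α(s) H(β_{G[s,r],Z})`; the
others are grouped by `k = s_Z` and contribute `α(+,+,k) · H(β̄_{Z,+,+,k})`.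
[cite: DupontEtAl2026, §2.3 eq. (4)] -/
def etaZ (P : Point) (r : Fin 6) : ℝ :=
  let cx := role r 0
  let cy := role r 1
  let cz := role r 2
  let α := P.alpha r
  (∑ s ∈ shapes2.filter (fun s => coord s cx = 0 ∨ coord s cy = 0),
      α s * Hb splitVecs (leafBeta P r s cz)) +
  ∑ k ∈ range 5,
    (let G := shapes2.filter (fun s => 0 < coord s cx ∧ 0 < coord s cy ∧ coord s cz = k)
     let W := ∑ s ∈ G, α s
     if W = 0 then 0 else W * Hb splitVecs (fun L => (∑ s ∈ G, α s * leafBeta P r s cz L) / W))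

/-- `β̄^{(r)}_{G,c,*,*,*} = ∑_s α^{(r)}(s) β_{G[s,r],c}`. [cite: DupontEtAl2026, §2.3 eq. (5)] -/
def betaBar (P : Point) (r : Fin 6) (c : Fin 3) (L : ℕ × ℕ) : ℝ :=
  ∑ s ∈ shapes2, P.alpha r s * leafBeta P r s c L

/-- The `X`-rôle term `H((α^{(r)})_X) − P_{S₂}(α^{(r)})` of eq. (5). [cite: DupontEtAl2026, §2.3 eq. (5)] -/
def regionTermX (P : Point) (r : Fin 6) : ℝ :=
  Hmarg shapes2 (P.alpha r) (role r 0) - penalty shapes2 (P.alpha r)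

/-- The `Y`-rôle term `H(β̄_{Y,*,*,*}) − η_Y` of eq. (5). [cite: DupontEtAl2026, §2.3 eq. (5)] -/
def regionTermY (P : Point) (r : Fin 6) : ℝ := Hb splitVecs (betaBar P r (role r 1)) - etaY P r

/-- The `Z`-rôle term `H(β̄_{Z,*,*,*}) − η_Z` of eq. (5). [cite: DupontEtAl2026, §2.3 eq. (5)] -/
def regionTermZ (P : Point) (r : Fin 6) : ℝ := Hb splitVecs (betaBar P r (role r 2)) - etaZ P r

/-- `E^{(r)}_G = min` of the three rôle terms (eq. (5)). [cite: DupontEtAl2026, §2.3 eq. (5)] -/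
def EGregion (P : Point) (r : Fin 6) : ℝ :=
  min (regionTermX P r) (min (regionTermY P r) (regionTermZ P r))

/-- `E_G = ∑_r A_G^{(r)} E_G^{(r)}`. [cite: DupontEtAl2026, §2.3 eq. (5)] -/
def EG (P : Point) : ℝ := ∑ r, P.A r * EGregion P r

/-! ## Program (11) at `ℓ* = 2` and Theorem 1 -/

/-- `E_total = E_G + E_2` (no levels `ℓ ≥ 3` at `ℓ* = 2`). [cite: DupontEtAl2026, §2.4] -/
def Etotal (P : Point) : ℝ := EG P + E2 P

/-- Feasibility of `(P, Ω)` for program (11) at hyper-parameters `(q, ℓ* = 2)`: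
`E_total + M_total · Ω ≥ 2^{ℓ*−1} log₂(q+2) = 2 log₂(q+2)`. [cite: DupontEtAl2026, §2.4 eq. (11)] -/
def Feasible (q : ℕ) (P : Point) (Ω : ℝ) : Prop :=
  2 * Real.logb 2 (q + 2) ≤ Etotal P + Mtotal q P * Ω

/-- `S₂` is exactly the set of triples of naturals summing to `2² = 4` (the note's definition of `S_ℓ`,
`ℓ = 2`; checks the explicit list `shapes2`). [cite: DupontEtAl2026, §2.1] -/
theorem mem_shapes2_iff (i j k : ℕ) : (i, j, k) ∈ shapes2 ↔ i + j + k = 4 := by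
  constructor
  · intro h
    simp only [shapes2, Finset.mem_insert, Finset.mem_singleton, Prod.mk.injEq] at h
    omega
  · intro h
    have hi : i ≤ 4 := by omega
    have hj : j ≤ 4 - i := by omega
    obtain rfl : k = 4 - i - j := by omega
    interval_cases i <;> interval_cases j <;> simp [shapes2]

/-- "The only remaining nodes are level-2 nodes with shapes `(1,1,2)`, `(1,2,1)`, or `(2,1,1)`, which are
the only valid strictly positive shapes for level 2." [cite: DupontEtAl2026, §2.2 (Level-2 node)] -/
theorem posShapes2_eq : posShapes2 = {(1, 1, 2), (1, 2, 1), (2, 1, 1)} := by decide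

/-- `C_{2,2} = {(0,2), (1,1), (2,0)}` — the support of `β_{T,Z}` in eq. (2). [cite: DupontEtAl2026, §2.3 eq. (2)] -/
theorem csplit2_two : csplit2 2 = {(0, 2), (1, 1), (2, 0)} := by decide

end CombinationLoss2

/-- **Theorem 1 of Dupont et al. 2026 (= Alman–Duan–Vassilevska Williams–Xu–Xu–Zhou 2025), case
`ℓ* = 2`:** for every integer `q ≥ 1`, every parameter point in the stated domains that is feasible for
program (11) with objective `Ω` certifies `ω ≤ Ω` (over `ℂ`).  Named fact (statement only; the proof is
the combination-loss laser method on `CW_q ⊗ CW_q`, Alman et al. 2025 §4–§6, not formalised; see the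
file docstring for the honest framing). [cite: DupontEtAl2026, §2.4 Thm. 1 and eq. (11); AlmanDuanVassilevskaWilliamsXuXuZhou2025, §7] -/
def combinationLoss2_theorem1 : Prop :=
  ∀ (q : ℕ), 1 ≤ q → ∀ (P : CombinationLoss2.Point) (Ω : ℝ),
    P.Valid → CombinationLoss2.Feasible q P Ω → omega ℂ ≤ Ω

namespace CombinationLoss2

/-! ## Valid certificates bound the penalty (note §2.5, eq. (12), Lemma 1)

Appended 2026-08-20 (pub-omega census, family (c)): the bridge from a §2.5 certificate to the
`sSup`-defined `hmax`/`penalty` above, via the proved abstract Lemma 1 of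
`MaxEntropyCertificate.lean`.  With it, "replacing each occurrence of `H^max_D` in the computation of
`E_total` with its upper bound can only decrease `E_total`" (§2.5) becomes available to a kernel check
of `Feasible`. -/

/-- A *valid certificate* for `H^max_D(ρ)` (§2.5, items 1–3 and eq. (12)): a strictly positive
`y ∈ Δ(D)` with the three marginals of `ρ`, potentials `g(a) = λ₀ + λ_X(a_X) + λ_Y(a_Y) + λ_Z(a_Z)`,
and `ε` with `|log₂ y(a) − g(a)| ≤ ε` on `D`.  (Stated for `y > 0` on all of `D`; when some marginal
value of `ρ` vanishes one first shrinks `D` to the cells with positive marginals, §2.5 item 1.)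
[cite: DupontEtAl2026, §2.5 eq. (12)] -/
structure Certificate (D : Finset Shape) (ρ : Shape → ℝ) where
  /-- the Gibbs-form distribution `y` -/
  y : Shape → ℝ
  /-- `λ₀` -/
  lam0 : ℝ
  /-- `λ_W(w)` for `W ∈ {X,Y,Z}` -/
  lam : Fin 3 → ℕ → ℝ
  /-- `ε` -/
  eps : ℝ
  y_pos : ∀ s ∈ D, 0 < y s
  y_sum : ∑ s ∈ D, y s = 1
  y_marg : ∀ c v, marg D y c v = marg D ρ c v
  eps_bound : ∀ s ∈ D, |Real.logb 2 (y s) - (lam0 + ∑ c, lam c (coord s c))| ≤ eps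

/-- The entropy of this file is the `Hbits` of `MaxEntropyCertificate.lean`. [folklore] -/
private theorem Hb_eq_Hbits {ι : Type*} (D : Finset ι) (f : ι → ℝ) :
    Hb D f = MaxEntropyCertificate.Hbits D f := rfl

/-- Summing a function over `D` fibrewise along the `X`-coordinate: two functions with the same
`X`-marginals have the same total. [folklore] -/
private theorem sum_eq_of_marg_eq {D : Finset Shape} {f g : Shape → ℝ}
    (h : ∀ v, marg D f 0 v = marg D g 0 v) : ∑ s ∈ D, f s = ∑ s ∈ D, g s := by
  rw [← Finset.sum_fiberwise_of_maps_to (g := fun s => coord s 0) (t := D.image fun s => coord s 0)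
      (fun s hs => Finset.mem_image_of_mem _ hs) (f := f),
    ← Finset.sum_fiberwise_of_maps_to (g := fun s => coord s 0) (t := D.image fun s => coord s 0)
      (fun s hs => Finset.mem_image_of_mem _ hs) (f := g)]
  exact Finset.sum_congr rfl fun v _ => h v

/-- **Lemma 1 for the program's `H^max`**: every admissible `ρ'` (nonnegative, with the marginals of
`ρ`) has `H(ρ') ≤ H(y) + 2ε` for a valid certificate of a `ρ` with `∑_D ρ = 1`.
[cite: DupontEtAl2026, §2.5 Lemma 1] -/
theorem Hb_le_of_certificate {D : Finset Shape} {ρ : Shape → ℝ} (C : Certificate D ρ)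
    (hρs : ∑ s ∈ D, ρ s = 1) {ρ' : Shape → ℝ} (h0 : ∀ s, 0 ≤ ρ' s)
    (hmarg : ∀ c v, marg D ρ' c v = marg D ρ c v) : Hb D ρ' ≤ Hb D C.y + 2 * C.eps := by
  have hsum' : ∑ s ∈ D, ρ' s = ∑ s ∈ D, ρ s := sum_eq_of_marg_eq fun v => hmarg 0 v
  have hysum' : ∑ s ∈ D, ρ' s = ∑ s ∈ D, C.y s := by rw [hsum', hρs, C.y_sum]
  rw [Hb_eq_Hbits, Hb_eq_Hbits]
  refine MaxEntropyCertificate.dupont2026_lemma1 D ρ' C.y (fun s => C.lam0 + ∑ c, C.lam c (coord s c))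
    C.eps (fun s _ => h0 s) C.y_pos (by rw [hsum', hρs]) C.y_sum ?_ C.eps_bound
  exact MaxEntropyCertificate.sum_sub_mul_potential_eq_zero D ρ' C.y (fun c s => coord s c) C.lam0 C.lam
    hysum' (fun c v => by
      have h1 := hmarg c v
      have h2 := C.y_marg c v
      unfold marg at h1 h2
      rw [h1, h2])

/-- **`H^max_D(ρ) ≤ H(y) + 2ε`** for a valid certificate (`ρ ∈ Δ(D)`), hence
**`P_D(ρ) ≤ H(y) + 2ε − H(ρ)`** — the bound substituted for the penalty in a certified evaluation of
program (11). [cite: DupontEtAl2026, §2.5 Lemma 1] -/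
theorem hmax_le_of_certificate {D : Finset Shape} {ρ : Shape → ℝ} (C : Certificate D ρ)
    (hρ0 : ∀ s, 0 ≤ ρ s) (hρD : ∀ s, s ∉ D → ρ s = 0) (hρs : ∑ s ∈ D, ρ s = 1) :
    hmax D ρ ≤ Hb D C.y + 2 * C.eps ∧ penalty D ρ ≤ Hb D C.y + 2 * C.eps - Hb D ρ := by
  have hne : {h : ℝ | ∃ ρ' : Shape → ℝ, (∀ s, 0 ≤ ρ' s) ∧ (∀ s, s ∉ D → ρ' s = 0) ∧
      (∀ c v, marg D ρ' c v = marg D ρ c v) ∧ h = Hb D ρ'}.Nonempty :=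
    ⟨Hb D ρ, ρ, hρ0, hρD, fun _ _ => rfl, rfl⟩
  have h1 : hmax D ρ ≤ Hb D C.y + 2 * C.eps := by
    refine csSup_le hne ?_
    rintro h ⟨ρ', h0, -, hmarg, rfl⟩
    exact Hb_le_of_certificate C hρs h0 hmarg
  exact ⟨h1, by unfold penalty; linarith⟩

end CombinationLoss2

end Literature.Computability.AlgebraicComplexity
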